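import Literature.MathematicalPhysics.QuantumFieldTheory.Balaban1983to89.B9CubeSequence408Mirrors
import Literature.MathematicalPhysics.QuantumFieldTheory.Balaban1983to89.B9CubeLettersOpsL0

/-!
# `Balaban1983to89.B9CubeDirichletLetterAtOne` — [Balaban1985BackgroundPropagators] p. 394, p. 408–409, Cor. 3.5 p. 407: PRINT's DIRICHLET CUBE LETTER `G′_□(1)`
# = `(Ω₀(□)Δ′_{a,□}(1)Ω₀(□))⁻¹` BY THE METHOD OF IMAGES — its two-sided inverse identity on `Ω₀(□)` (node00-def-Y's socket `GpDirY_one_eq_liftOpY (hK)`) and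
# THEOREM 3.1 (3.42)₁ AT `U = 1` for it, block-majorant form over the cube family's geometry (ROAD (I) «IMAGES», file D3c-β)

FRAMING (verbatim cell line):
statement-level skeleton of published theorems with citation tags; proofs where landed; nothing here is a claim about the Yang–Mills mass gap

Sources: T. Bałaban, *Propagators for lattice gauge theories in a background field*, Commun. Math. Phys. **99** (1985) 389–434
[`Balaban1985BackgroundPropagators`], p. 394 («Δ′_a(U)↾Ω₀ = Ω₀Δ′_a(U)Ω₀ … Its inverse is denoted by G′(U)»), Thm 3.1 (3.42) p. 397, Cor. 3.5 p. 407 («U = 1»),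
p. 408–409 («{Ω_n(□)} … The operators constructed for this sequence, which we denote by G′_□(U) … satisfy all the inequalities of Theorems 3.1–3.3»);
T. Bałaban, *Propagators and renormalization transformations for lattice gauge theories. II*, Commun. Math. Phys. **96** (1984) 223–250 [`Balaban1984PropagatorsII`],
Prop. 2.2 (2.67)₁ p. 234, (2.51) p. 232, (2.14) p. 225; T. Bałaban, *Regularity and decay of lattice Green's functions*, Commun. Math. Phys. **89** (1983) 571–597
[`Balaban1983RegularityDecay`], (2.42) p. 584.  Unit `pub-ymgap-dag-n06-c` (g31); consumer node00-def-Y g38 ✓`Node00/OpsYCubeDirInverse` (`GpDirY`, socket `hK`).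

## WHAT THIS FILE CERTIFIES (kernel-checked; `η = 1`, `L = ℓ + 1`; weights r05's `wCube L` = print's `(a_j)` of (3.24) at `a = 1`)

For a global family `D`, a cover cube `q`, the cube family `F = cubeFam D q` with operator `M_□ = Δ′_{a,□}(1) = mlOpT N₀ L k lev_F (wCube L)` and the Dirichlet domain
`Ω₀(□) = dirDomC D q` of D3c-α:
* `GpDirBox` — the inverse of the compression of `M_□` to the open mirror box; `GpDirOne D q …` — **`G′_□(1)` AS A KERNEL ON THE MEMBER's TORUS**, zero off
  `Ω₀(□) × Ω₀(□)` (`GpDirOne_apply_of_not_mem_left∕right`), on it the signed image sum `Σ_ε (−1)^{#ε} G′[F′](x, σ_ε y)` of the torus Green's function of the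
  reflected cube family (`GpDirOne_apply_of_mem`, D3b `inv_compress_emb_eq_signedImK`);
* ★★ `compress_mul_GpDirOne` ∕ `GpDirOne_mul_compress` — **THE SOCKET**: `M_□.submatrix val val * (GpDirOne).submatrix val val = 1` on `↥Ω₀(□)` (and the other
  order) — literally node00-def-Y's `hK` for `S := Ω₀(□)`, `K := GpDirOne`; `compress_mul_GpDirOneY` the same at def-Y's index (`cubeFamY i q`, `(toKT i).NB`);
* ★★★ `hasMajorant_GpDirOne` — **THEOREM 3.1 (3.42)₁ AT `U = 1` FOR `G′_□(1)`**: with constants `δ₀, C, M₀, N₀` depending on `d, L` only, for `M_h ≥ 3`,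
  `L·M_h ≥ M₀`, `R ≥ 2L`, `R·L·M_h ≥ N₀ + 1`, `P_μ ≥ 4`:
  `HasMajorant (geomT F) (blkOf F) (toLin' G′_□(1)) (2^{d+1}·C·L^{2j(y)}·e^{−(δ₀/2) d_F(y,y′)})` — p33's window census `prop22_first_multiLevelTorus` at the REFLECTED
  cube family `(reflC D q, wCube, cCube)` (an honest `…L0` family on the doubled torus, D2b), folded by D3d′ `dirichlet_hasMajorant` (D3c-α discharging FIT and
  MARGIN) and read on the member's torus through `embEquivC` (`#mirIdx ≤ 2^{d+1}`).  Same shape and constants (× `2^{d+1}`) as r05's torus letter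
  `B9Thm31CubeLocalFlat.thm31_cubeW_flat_first`.

## HONEST SCOPE

`U = 1` only (Cor. 3.5's case; the `U`-dependence is Sect. B's perturbation, lanes n06-d ∕ def-Y); the first entry of (3.42) only (entries 2, 3, 6 fold the same way
from `prop22_second∕third∕sixth_multiLevelTorus` — file D3e); `Ω₀(□)` as declared in D3c-α (O(L) top blocks about `C₁(□)`).  Nothing continuum ∕ OS ∕ Clay; N06 is
not discharged by this file; the YM mass gap is not proved by any of this.
-/

namespace Literature.MathematicalPhysics.QuantumFieldTheory.Balaban1983to89.B9CubeDirichletLetterAtOne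

noncomputable section

open Finset Matrix
open Literature.MathematicalPhysics.QuantumFieldTheory.Balaban1983to89.B4Reflection242 (boxDom mem_boxDom blk)
open Literature.MathematicalPhysics.QuantumFieldTheory.Balaban1983to89.B6MultiLevelBoxOperator (N0 bigSide one_le_bigSide)
open Literature.MathematicalPhysics.QuantumFieldTheory.Balaban1983to89.B6MultiLevelTorusOperator (twrap tshift mlOpT gmlT one_le_of_mem one_le_N0)
open Literature.MathematicalPhysics.QuantumFieldTheory.Balaban1983to89.B6MultiLevelTorusOperatorL0 (TDomains)
open Literature.MathematicalPhysics.QuantumFieldTheory.Balaban1983to89.B6Cover236MultiLevelBlocks (cubes)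
open Literature.MathematicalPhysics.QuantumFieldTheory.Balaban1983to89.B6Geom246MultiLevelBoxL0 (bset blkOf blkOf_val)
open Literature.MathematicalPhysics.QuantumFieldTheory.Balaban1983to89.B6Geom246MultiLevelTorusL0 (bondT geomT)
open Literature.MathematicalPhysics.QuantumFieldTheory.Balaban1983to89.B6RandomWalk (HasMajorant BlockSupp hasMajorant_mono)
open Literature.MathematicalPhysics.QuantumFieldTheory.Balaban1983to89.B6Ineq243TwoLevelBox (aNext)
open Literature.MathematicalPhysics.QuantumFieldTheory.Balaban1983to89.B6Prop22MultiLevelTorusL0 (prop22_first_multiLevelTorus)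
open Literature.MathematicalPhysics.QuantumFieldTheory.Balaban1983to89.B9CubeSequence408 (cubeFam)
open Literature.MathematicalPhysics.QuantumFieldTheory.Balaban1983to89.B9Thm31CubeLocalFlat (wCube cCube wCube_pos wCube_window cCube_window wCube_rec amin_pos)
open Literature.MathematicalPhysics.QuantumFieldTheory.Balaban1983to89.B9CubeLettersOpsL0 (cubeFamY oddMh)
open Literature.MathematicalPhysics.QuantumFieldTheory.Balaban1983to89.B6KLevelCensusIndexV1 (KIdx)
open Literature.MathematicalPhysics.QuantumFieldTheory.Balaban1983to89.Node00 (toKT)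
open Literature.MathematicalPhysics.QuantumFieldTheory.Balaban1983to89.B4Eq242TorusMirrors
open Literature.MathematicalPhysics.QuantumFieldTheory.Balaban1983to89.B6MultiLevelTorusMirrorL0
open Literature.MathematicalPhysics.QuantumFieldTheory.Balaban1983to89.B6MultiLevelTorusMirrorCompression
open Literature.MathematicalPhysics.QuantumFieldTheory.Balaban1983to89.B6MultiLevelTorusMirrorMajorant
open Literature.MathematicalPhysics.QuantumFieldTheory.Balaban1983to89.B4Eq242SignedImages (signedImK)
open Literature.MathematicalPhysics.QuantumFieldTheory.Balaban1983to89.B9CubeSequence408Mirrors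

variable {d : ℕ}

/-! ## §1  The Dirichlet cube letter at `U = 1` -/

section Letter

variable {ℓ Mh k R : ℕ} {P : Fin (d + 1) → ℕ}

/-- `G′_□(1)` ON THE OPEN MIRROR BOX: the inverse of the compression of `Δ′_{a,□}(1)` to the embedded box. [cite: Balaban1985BackgroundPropagators, p.394 («Its inverse is denoted by G′»), p.409] -/
def GpDirBox (D : B6MultiLevelTorusOperator.TDomains d ℓ Mh k P R) (q : ↥(cubes D.toDomains))
    (hL : Odd (ℓ + 1)) (hM : Odd Mh) (hMh : 1 ≤ Mh) (hP : ∀ μ, 1 ≤ P μ) : Matrix ↥(boxC D q) ↥(boxC D q) ℝ :=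
  ((mlOpT (N0 ℓ Mh k P) ℓ k (cubeFam D q hL hM hMh hP).lev (wCube ℓ)).submatrix
    (fun v : ↥(boxC D q) => (⟨B6MultiLevelTorusMirrorL0.emb (ℓ := ℓ) (Mh := Mh) (k := k) (P := P) (gC q) v.1.1, emb_mem hMh hP (gC q) v.1.1⟩ : ↥(boxDom (N0 ℓ Mh k P))))
    (fun v : ↥(boxC D q) => (⟨B6MultiLevelTorusMirrorL0.emb (ℓ := ℓ) (Mh := Mh) (k := k) (P := P) (gC q) v.1.1, emb_mem hMh hP (gC q) v.1.1⟩ : ↥(boxDom (N0 ℓ Mh k P)))))⁻¹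

/-- **PRINT's DIRICHLET CUBE LETTER `G′_□(1)` AS A KERNEL ON THE MEMBER's TORUS**: `GpDirBox` read through `Ω₀(□) ≃ box`, zero off `Ω₀(□) × Ω₀(□)`.
[cite: Balaban1985BackgroundPropagators, p.394 («Δ′_a(U)↾Ω₀ = Ω₀Δ′_a(U)Ω₀ … G′(U)»), p.409 («G′_□(U)»)] -/
def GpDirOne (D : B6MultiLevelTorusOperator.TDomains d ℓ Mh k P R) (q : ↥(cubes D.toDomains))
    (hL : Odd (ℓ + 1)) (hM : Odd Mh) (hMh : 1 ≤ Mh) (hP : ∀ μ, 1 ≤ P μ) : Matrix ↥(boxDom (N0 ℓ Mh k P)) ↥(boxDom (N0 ℓ Mh k P)) ℝ :=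
  fun z w => if h : z ∈ dirDomC D q hMh hP ∧ w ∈ dirDomC D q hMh hP then
    GpDirBox D q hL hM hMh hP ((embEquivC D q hMh hP).symm ⟨z, h.1⟩) ((embEquivC D q hMh hP).symm ⟨w, h.2⟩) else 0

variable {D : B6MultiLevelTorusOperator.TDomains d ℓ Mh k P R} {q : ↥(cubes D.toDomains)}
  {hL : Odd (ℓ + 1)} {hM : Odd Mh} {hMh : 1 ≤ Mh} {hP : ∀ μ, 1 ≤ P μ}

/-- `G′_□(1)(z, w) = 0` for `z ∉ Ω₀(□)`. [cite: Balaban1985BackgroundPropagators, p.394 (Dirichlet rows), bookkeeping] -/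
theorem GpDirOne_apply_of_not_mem_left {z : ↥(boxDom (N0 ℓ Mh k P))} (hz : z ∉ dirDomC D q hMh hP) (w : ↥(boxDom (N0 ℓ Mh k P))) :
    GpDirOne D q hL hM hMh hP z w = 0 := by
  unfold GpDirOne; rw [dif_neg (fun h => hz h.1)]

/-- `G′_□(1)(z, w) = 0` for `w ∉ Ω₀(□)`. [cite: Balaban1985BackgroundPropagators, p.394 (Dirichlet columns), bookkeeping] -/
theorem GpDirOne_apply_of_not_mem_right (z : ↥(boxDom (N0 ℓ Mh k P))) {w : ↥(boxDom (N0 ℓ Mh k P))} (hw : w ∉ dirDomC D q hMh hP) :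
    GpDirOne D q hL hM hMh hP z w = 0 := by
  unfold GpDirOne; rw [dif_neg (fun h => hw h.2)]

/-- `G′_□(1)` at two embedded box sites is the box inverse. [cite: Balaban1985BackgroundPropagators, p.394, bookkeeping] -/
theorem GpDirOne_embC (x y : ↥(boxC D q)) :
    GpDirOne D q hL hM hMh hP (embC D q hMh hP x).1 (embC D q hMh hP y).1 = GpDirBox D q hL hM hMh hP x y := by
  unfold GpDirOne
  rw [dif_pos ⟨(embC D q hMh hP x).2, (embC D q hMh hP y).2⟩]
  have ex : (embEquivC D q hMh hP).symm ⟨(embC D q hMh hP x).1, (embC D q hMh hP x).2⟩ = x := by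
    rw [Equiv.symm_apply_eq]; rfl
  have ey : (embEquivC D q hMh hP).symm ⟨(embC D q hMh hP y).1, (embC D q hMh hP y).2⟩ = y := by
    rw [Equiv.symm_apply_eq]; rfl
  rw [ex, ey]

/-- `G′_□(1)` compressed to `Ω₀(□)`, reindexed by the box, is the box inverse. [cite: Balaban1985BackgroundPropagators, p.394, bookkeeping] -/
theorem submatrix_GpDirOne_embEquivC :
    ((GpDirOne D q hL hM hMh hP).submatrix (fun v : ↥(dirDomC D q hMh hP) => v.1) (fun v : ↥(dirDomC D q hMh hP) => v.1)).submatrix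
      (embEquivC D q hMh hP) (embEquivC D q hMh hP) = GpDirBox D q hL hM hMh hP := by
  ext x y
  simp only [Matrix.submatrix_apply, embEquivC_apply]
  exact GpDirOne_embC x y

/-- ★ `G′_□(1)` ON `Ω₀(□)` IS THE SIGNED IMAGE SUM of the torus Green's function of the reflected cube family:
`G′_□(1)(emb x, emb y) = Σ_{ε ≤ mir} (−1)^{#ε} G′[F′](x, σ_ε y)`. [cite: Balaban1983RegularityDecay, (2.42) p.584; Balaban1985BackgroundPropagators, p.394, p.409] -/
theorem GpDirOne_apply_of_mem (hℓ : 1 ≤ ℓ) (x y : ↥(boxC D q)) :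
    GpDirOne D q hL hM hMh hP (embC D q hMh hP x).1 (embC D q hMh hP y).1 =
      ∑ ε ∈ mirIdx (mirC q), tsign ℝ (mirC q) ε *
        gmlT (N0 ℓ Mh (kTop q) (Pref ℓ k (kTop q) P (mirC q) (mC q))) ℓ (kTop q) (reflC D q hL hM hMh hP).lev (wCube ℓ) x.1
          (trefl (hmir_of_top (k := k) (P := P) hL hM hMh (two_le_mC q)) ε y.1) := by
  rw [GpDirOne_embC]
  unfold GpDirBox
  rw [inv_compress_emb_eq_signedImK (hL := hL) (hM := hM) (hMh := hMh) (hP := hP) (hk := kTop_le q) (hlev := lev_cubeFam_le_kTop q)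
    (hm := two_le_mC q) (hg := sTop_dvd_gC q) (fitC hMh q) (wCube ℓ) (wCube_pos hℓ) (margC q)]
  rfl

/-- ★★ **THE SOCKET (node00-def-Y `GpDirY_one_eq_liftOpY (hK)`)**: `Ω₀Δ′_{a,□}(1)Ω₀ · Ω₀G′_□(1)Ω₀ = 1_{Ω₀}` — the compression of the cube operator to `Ω₀(□)` times the
compression of `G′_□(1)` is the identity. [cite: Balaban1985BackgroundPropagators, p.394 («Its inverse is denoted by G′»), Cor. 3.5 p.407, p.409; Balaban1983RegularityDecay, (2.42) p.584] -/
theorem compress_mul_GpDirOne (hℓ : 1 ≤ ℓ) :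
    (mlOpT (N0 ℓ Mh k P) ℓ k (cubeFam D q hL hM hMh hP).lev (wCube ℓ)).submatrix (fun v : ↥(dirDomC D q hMh hP) => v.1) (fun v : ↥(dirDomC D q hMh hP) => v.1) *
      (GpDirOne D q hL hM hMh hP).submatrix (fun v : ↥(dirDomC D q hMh hP) => v.1) (fun v : ↥(dirDomC D q hMh hP) => v.1) = 1 := by
  -- on the box: the compression of D3b is invertible (FIT, MARGIN discharged in D3c-α), `GpDirBox` is its inverse
  have hU := isUnit_compress_emb (hL := hL) (hM := hM) (hMh := hMh) (hP := hP) (hk := kTop_le q) (hlev := lev_cubeFam_le_kTop q)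
    (hm := two_le_mC q) (hg := sTop_dvd_gC q) (fitC hMh q) (wCube ℓ) (wCube_pos hℓ) (margC (D := D) (hL := hL) (hM := hM) (hMh := hMh) (hP := hP) q)
  have hbox : (mlOpT (N0 ℓ Mh k P) ℓ k (cubeFam D q hL hM hMh hP).lev (wCube ℓ)).submatrix
      (fun v : ↥(boxC D q) => (⟨B6MultiLevelTorusMirrorL0.emb (ℓ := ℓ) (Mh := Mh) (k := k) (P := P) (gC q) v.1.1, emb_mem hMh hP (gC q) v.1.1⟩ : ↥(boxDom (N0 ℓ Mh k P))))
      (fun v : ↥(boxC D q) => (⟨B6MultiLevelTorusMirrorL0.emb (ℓ := ℓ) (Mh := Mh) (k := k) (P := P) (gC q) v.1.1, emb_mem hMh hP (gC q) v.1.1⟩ : ↥(boxDom (N0 ℓ Mh k P)))) *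
      GpDirBox D q hL hM hMh hP = 1 := by
    unfold GpDirBox
    exact Matrix.mul_nonsing_inv _ ((Matrix.isUnit_iff_isUnit_det _).1 hU)
  -- transport along `Ω₀(□) ≃ box`
  have key : ∀ X Y : Matrix ↥(dirDomC D q hMh hP) ↥(dirDomC D q hMh hP) ℝ,
      X.submatrix (embEquivC D q hMh hP) (embEquivC D q hMh hP) * Y.submatrix (embEquivC D q hMh hP) (embEquivC D q hMh hP) = 1 → X * Y = 1 := by
    intro X Y h
    rw [Matrix.submatrix_mul_equiv] at h
    have h' : ((X * Y).submatrix (embEquivC D q hMh hP) (embEquivC D q hMh hP)).submatrix (embEquivC D q hMh hP).symm (embEquivC D q hMh hP).symm =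
        (1 : Matrix ↥(boxC D q) ↥(boxC D q) ℝ).submatrix (embEquivC D q hMh hP).symm (embEquivC D q hMh hP).symm := by rw [h]
    rw [Matrix.submatrix_submatrix, Matrix.submatrix_one_equiv, Equiv.self_comp_symm, Matrix.submatrix_id_id] at h'
    exact h'
  apply key
  have hA : ((mlOpT (N0 ℓ Mh k P) ℓ k (cubeFam D q hL hM hMh hP).lev (wCube ℓ)).submatrix (fun v : ↥(dirDomC D q hMh hP) => v.1) (fun v : ↥(dirDomC D q hMh hP) => v.1)).submatrix
      (embEquivC D q hMh hP) (embEquivC D q hMh hP) =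
      (mlOpT (N0 ℓ Mh k P) ℓ k (cubeFam D q hL hM hMh hP).lev (wCube ℓ)).submatrix
      (fun v : ↥(boxC D q) => (⟨B6MultiLevelTorusMirrorL0.emb (ℓ := ℓ) (Mh := Mh) (k := k) (P := P) (gC q) v.1.1, emb_mem hMh hP (gC q) v.1.1⟩ : ↥(boxDom (N0 ℓ Mh k P))))
      (fun v : ↥(boxC D q) => (⟨B6MultiLevelTorusMirrorL0.emb (ℓ := ℓ) (Mh := Mh) (k := k) (P := P) (gC q) v.1.1, emb_mem hMh hP (gC q) v.1.1⟩ : ↥(boxDom (N0 ℓ Mh k P)))) := by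
    ext x y; rfl
  exact (congrArg₂ (· * ·) hA (submatrix_GpDirOne_embEquivC (hL := hL) (hM := hM) (hMh := hMh) (hP := hP))).trans hbox

/-- the other order: `Ω₀G′_□(1)Ω₀ · Ω₀Δ′_{a,□}(1)Ω₀ = 1_{Ω₀}`. [cite: Balaban1985BackgroundPropagators, p.394, Cor. 3.5 p.407] -/
theorem GpDirOne_mul_compress (hℓ : 1 ≤ ℓ) :
    (GpDirOne D q hL hM hMh hP).submatrix (fun v : ↥(dirDomC D q hMh hP) => v.1) (fun v : ↥(dirDomC D q hMh hP) => v.1) *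
      (mlOpT (N0 ℓ Mh k P) ℓ k (cubeFam D q hL hM hMh hP).lev (wCube ℓ)).submatrix (fun v : ↥(dirDomC D q hMh hP) => v.1) (fun v : ↥(dirDomC D q hMh hP) => v.1) = 1 :=
  mul_eq_one_comm.1 (compress_mul_GpDirOne hℓ)

end Letter

/-! ## §2  The socket at node00-def-Y's index -/

section IndexY

variable {ℓ : ℕ} {hd : 1 ≤ d + 1} {hL : Odd (ℓ + 1) ∧ 1 < ℓ + 1} {b₀ b₁ : ℝ}

/-- ★ THE SOCKET AT def-Y's INDEX: for a member `i` and a cover cube `q`, with `S := Ω₀(□) = dirDomC (toKT i).D q …` and `K := GpDirOne (toKT i).D q …`, the binder `hK` of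
`Node00.OpsYCubeDirInverse.GpDirY_one_eq_liftOpY` holds. [cite: Balaban1985BackgroundPropagators, p.394, Cor. 3.5 p.407, p.409; Balaban1983RegularityDecay, (2.42) p.584] -/
theorem compress_mul_GpDirOneY (i : KIdx d ℓ hd hL b₀ b₁) (q : ↥(cubes (toKT i).D.toDomains)) :
    (mlOpT (toKT i).NB ℓ (toKT i).k (cubeFamY i q).lev (wCube ℓ)).submatrix
        (fun v : ↥(dirDomC (toKT i).D q (toKT i).hMh (toKT i).hP) => v.1) (fun v : ↥(dirDomC (toKT i).D q (toKT i).hMh (toKT i).hP) => v.1) *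
      (GpDirOne (toKT i).D q hL.1 (oddMh i) (toKT i).hMh (toKT i).hP).submatrix
        (fun v : ↥(dirDomC (toKT i).D q (toKT i).hMh (toKT i).hP) => v.1) (fun v : ↥(dirDomC (toKT i).D q (toKT i).hMh (toKT i).hP) => v.1) = 1 := by
  have hℓ : 1 ≤ ℓ := by have := hL.2; omega
  exact compress_mul_GpDirOne hℓ

end IndexY

/-! ## §3  Theorem 3.1 (3.42)₁ at `U = 1` for the Dirichlet cube letter -/

section Decay

/-- `#(mirIdx mir) ≤ 2^{d+1}`. [cite: Balaban1983RegularityDecay, (2.42) p.584 (the `2^{#mir}` images), bookkeeping] -/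
theorem card_mirIdx_le (mir : Fin (d + 1) → Bool) : ((mirIdx mir).card : ℝ) ≤ 2 ^ (d + 1) := by
  have h : (mirIdx mir).card ≤ Fintype.card (Fin (d + 1) → Bool) := Finset.card_le_univ _
  rw [Fintype.card_fun, Fintype.card_bool, Fintype.card_fin] at h
  exact_mod_cast h

/-- ★★★ **THEOREM 3.1 (3.42)₁ AT `U = 1` FOR PRINT's DIRICHLET CUBE LETTER `G′_□(1)`**, block-majorant form over the cube family's geometry: with `δ₀, C, M₀, N₀` depending on
`d, L` only, `|(G′_□(1)λ)(x)| ≤ 2^{d+1}·C·L^{2j(y)}·e^{−(δ₀/2) d_F(y,y′)}·|λ|` for `x ∈ B(y)`, `supp λ ⊂ B(y′)` (blocks of `F = cubeFam D q`).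
[cite: Balaban1985BackgroundPropagators, Thm 3.1 (3.42) p.397 (first entry) with Cor. 3.5 p.407 and p.409 l.1–5, p.394; Balaban1984PropagatorsII, Prop. 2.2 (2.67)₁ p.234, (2.51) p.232; Balaban1983RegularityDecay, (2.42) p.584] -/
theorem hasMajorant_GpDirOne (d ℓ : ℕ) (hℓ : 1 ≤ ℓ) :
    ∃ δ₀ C M₀ : ℝ, ∃ N₀ : ℕ, 0 < δ₀ ∧ 0 < C ∧ 0 < M₀ ∧ 0 < N₀ ∧
      ∀ {Mh k R : ℕ} {P : Fin (d + 1) → ℕ} (D : B6MultiLevelTorusOperator.TDomains d ℓ Mh k P R)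
        (q : ↥(cubes D.toDomains)) (hL : Odd (ℓ + 1)) (hM : Odd Mh) (hMh : 1 ≤ Mh) (hP : ∀ μ, 1 ≤ P μ),
        3 ≤ Mh → M₀ ≤ ((ℓ : ℝ) + 1) * Mh → 2 * (ℓ + 1) ≤ R → N₀ + 1 ≤ R * ((ℓ + 1) * Mh) → (∀ μ, 4 ≤ P μ) →
        HasMajorant (g := geomT (cubeFam D q hL hM hMh hP)) (blkOf (cubeFam D q hL hM hMh hP).toDomains)
          (Matrix.toLin' (GpDirOne D q hL hM hMh hP))
          (fun y y' => 2 ^ (d + 1) * C * ((ℓ : ℝ) + 1) ^ (2 * y.1.1) *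
            Real.exp (-(δ₀ / 2 * (geomT (cubeFam D q hL hM hMh hP)).dist y y'))) := by
  obtain ⟨δ₀, C, M₀, N₀, hδ₀, hC, hM₀, hN₀, h⟩ :=
    prop22_first_multiLevelTorus d ℓ hℓ (1 - ((((ℓ : ℝ) + 1)) ^ 2)⁻¹) 1 1 (1 - ((((ℓ : ℝ) + 1)) ^ 2)⁻¹)⁻¹ (amin_pos hℓ) one_pos
  refine ⟨δ₀, C, M₀, N₀, hδ₀, hC, hM₀, hN₀, ?_⟩
  intro Mh k R P D q hL hM hMh hP h3 hM0 hR hN0 hP4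
  classical
  -- the window census at the reflected cube family
  have hP' : ∀ μ, 1 ≤ Pref ℓ k (kTop q) P (mirC q) (mC q) μ := fun μ => by
    unfold Pref; split_ifs with hμ
    · have := two_le_mC q μ hμ; omega
    · exact le_trans (hP μ) (Nat.le_mul_of_pos_left _ (Nat.pow_pos (Nat.succ_pos ℓ)))
  have hP4' : ∀ μ, 4 ≤ Pref ℓ k (kTop q) P (mirC q) (mC q) μ := fun μ => by
    unfold Pref; split_ifs with hμ
    · have := two_le_mC q μ hμ; omega
    · exact le_trans (hP4 μ) (Nat.le_mul_of_pos_left _ (Nat.pow_pos (Nat.succ_pos ℓ)))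
  have hK' := h (kTop q) Mh R h3 hM0 hR hN0 (Pref ℓ k (kTop q) P (mirC q) (mC q)) hP' hP4' (reflC D q hL hM hMh hP) (wCube ℓ) (cCube ℓ)
    (wCube_window hℓ) (cCube_window hℓ) (wCube_rec hℓ)
  -- fold it to the Dirichlet Green's function on the box
  have hφ : ∀ j : ℕ, 0 ≤ C * ((ℓ : ℝ) + 1) ^ (2 * j) := fun j => by positivity
  have hbox := dirichlet_hasMajorant (F := cubeFam D q hL hM hMh hP) (hL := hL) (hM := hM) (hMh := hMh) (hP := hP) (hk := kTop_le q)
    (hlev := lev_cubeFam_le_kTop q) (hm := two_le_mC q) (hg := sTop_dvd_gC q) (fitC hMh q) (wCube ℓ) (wCube_pos hℓ) (margC q)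
    (φ := fun j => C * ((ℓ : ℝ) + 1) ^ (2 * j)) hφ (δ := δ₀ / 2) (by positivity) hK'
  -- read it on the member's torus
  intro y' μ B hμ z
  have hRHS : 0 ≤ 2 ^ (d + 1) * C * ((ℓ : ℝ) + 1) ^ (2 * (blkOf (cubeFam D q hL hM hMh hP).toDomains z).1.1) *
      Real.exp (-(δ₀ / 2 * (geomT (cubeFam D q hL hM hMh hP)).dist (blkOf (cubeFam D q hL hM hMh hP).toDomains z) y')) * B :=
    mul_nonneg (mul_nonneg (by positivity) (Real.exp_nonneg _)) hμ.nonneg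
  rw [Matrix.toLin'_apply]
  by_cases hz : z ∈ dirDomC D q hMh hP
  · -- `z = emb x`: the row of `G′_□(1)` is the row of the box inverse against `μ ∘ emb`
    set e := embEquivC D q hMh hP with he
    set x := e.symm ⟨z, hz⟩ with hx
    have hzx : z = (embC D q hMh hP x).1 := by
      have : e x = ⟨z, hz⟩ := by rw [hx, Equiv.apply_symm_apply]
      rw [embEquivC_apply] at this
      exact congrArg Subtype.val this.symm
    set ν : ↥(boxC D q) → ℝ := fun v => μ (embC D q hMh hP v).1 with hν
    have hrow : (GpDirOne D q hL hM hMh hP *ᵥ μ) z = (GpDirBox D q hL hM hMh hP *ᵥ ν) x := by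
      rw [Matrix.mulVec, Matrix.mulVec, dotProduct, dotProduct]
      -- drop the columns off `Ω₀(□)`, pass to the subtype, reindex by the box
      rw [← Finset.sum_subset (Finset.subset_univ (dirDomC D q hMh hP))
        (fun w _ hw => by rw [GpDirOne_apply_of_not_mem_right z hw, zero_mul])]
      rw [← Finset.sum_coe_sort (dirDomC D q hMh hP), ← Equiv.sum_comp e]
      refine Finset.sum_congr rfl fun v _ => ?_
      rw [hzx, embEquivC_apply]
      show GpDirOne D q hL hM hMh hP (embC D q hMh hP x).1 (embC D q hMh hP v).1 * μ (embC D q hMh hP v).1 = _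
      rw [GpDirOne_embC]
    have hνs : BlockSupp (g := geomT (cubeFam D q hL hM hMh hP))
        (fun v : ↥(boxC D q) => blkOf (cubeFam D q hL hM hMh hP).toDomains
          ⟨B6MultiLevelTorusMirrorL0.emb (ℓ := ℓ) (Mh := Mh) (k := k) (P := P) (gC q) v.1.1, emb_mem hMh hP (gC q) v.1.1⟩) ν y' B :=
      ⟨hμ.nonneg, fun v hv => hμ.bound _ hv, fun v hv => hμ.off _ hv⟩
    have hb := hbox y' ν B hνs x
    rw [Matrix.toLin'_apply] at hb
    have hbx : blkOf (cubeFam D q hL hM hMh hP).toDomains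
        ⟨B6MultiLevelTorusMirrorL0.emb (ℓ := ℓ) (Mh := Mh) (k := k) (P := P) (gC q) x.1.1, emb_mem hMh hP (gC q) x.1.1⟩ =
          blkOf (cubeFam D q hL hM hMh hP).toDomains z := by rw [hzx]; rfl
    have hb' : |(GpDirBox D q hL hM hMh hP *ᵥ ν) x| ≤ ((mirIdx (mirC q)).card : ℝ) * (C * ((ℓ : ℝ) + 1) ^ (2 * (blkOf (cubeFam D q hL hM hMh hP).toDomains z).1.1)) *
        Real.exp (-(δ₀ / 2 * (geomT (cubeFam D q hL hM hMh hP)).dist (blkOf (cubeFam D q hL hM hMh hP).toDomains z) y')) * B := by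
      have := hb
      dsimp only at this
      rw [hbx] at this
      exact this
    rw [hrow]
    refine hb'.trans ?_
    apply mul_le_mul_of_nonneg_right _ hμ.nonneg
    apply mul_le_mul_of_nonneg_right _ (Real.exp_nonneg _)
    have hc := card_mirIdx_le (mirC q)
    have h0 : 0 ≤ C * ((ℓ : ℝ) + 1) ^ (2 * (blkOf (cubeFam D q hL hM hMh hP).toDomains z).1.1) := hφ _
    calc ((mirIdx (mirC q)).card : ℝ) * (C * ((ℓ : ℝ) + 1) ^ (2 * (blkOf (cubeFam D q hL hM hMh hP).toDomains z).1.1))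
        ≤ 2 ^ (d + 1) * (C * ((ℓ : ℝ) + 1) ^ (2 * (blkOf (cubeFam D q hL hM hMh hP).toDomains z).1.1)) := mul_le_mul_of_nonneg_right hc h0
      _ = 2 ^ (d + 1) * C * ((ℓ : ℝ) + 1) ^ (2 * (blkOf (cubeFam D q hL hM hMh hP).toDomains z).1.1) := by ring
  · -- off `Ω₀(□)` the row vanishes
    have : (GpDirOne D q hL hM hMh hP *ᵥ μ) z = 0 := by
      rw [Matrix.mulVec, dotProduct]
      exact Finset.sum_eq_zero fun w _ => by rw [GpDirOne_apply_of_not_mem_left hz, zero_mul]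
    rw [this, abs_zero]
    exact hRHS

end Decay

end

end Literature.MathematicalPhysics.QuantumFieldTheory.Balaban1983to89.B9CubeDirichletLetterAtOne
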